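import Summits.NavierStokesRegularity.NavierStokesRegularity.Theorems.TypeICertificateLadderTargetSolitonLaws
import Summits.NavierStokesRegularity.NavierStokesRegularity.Theorems.TypeICertificateLadderTargetTwistedHeadIdentity
import Summits.NavierStokesRegularity.NavierStokesRegularity.Theorems.TypeICertificateLadderTargetWeightedGapLemma
import HarnessLib

/-!
# Crux `Target` (stmt-NavierStokesRegularity-1217), line `killing-twisted-bernoulli-solitons`:
  the AXIAL-VORTICITY STRATUM of the window stub B5b (modulo the conjugate density, stub B2)

Support file (theorems only, `--supports stmt-NavierStokesRegularity-1217`). The landed stubs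
B1 (`stub_twistedHeadIdentity`), B3 (`stub_solitonLaws`) and B4 (`stub_weightedGapLemma`) of the
line give, for a Type-I rotated self-similar solution of Pineau–Vicol's class
(arXiv:2607.09619, Thm. 1.4) carrying a rotating conjugate density `m` (the package of stub B2),
the SOLITON IDENTITY `∫ |curl U|² m = 2α ∫ (curl U)₂ m` and the gap threshold. Read pointwise
this is a Liouville theorem for a whole stratum of profiles, with NO smallness and for EVERY
rotation rate:

* `axialVorticity_liouville_of_density` — given B2 (hypothesis `h2`, verbatim the registered
  signature, consumed exactly as in the skeleton's `rssLiouville_of_parts`): if the axial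
  vorticity does not co-rotate anywhere, `α (curl U)₂(y) ≤ 0` for all `y`, then `U = 0`
  (the conjugate enstrophy is `2 ∫ α(curl U)₂ m ≤ 0 < ε₀`);
* `noAxialVorticity_liouville_of_density` — in particular a Type-I soliton whose profile has
  NO AXIAL VORTICITY, `(curl U)₂ ≡ 0` (horizontal velocity irrotational in every horizontal
  plane, `∂₁U₂ = ∂₂U₁`; this contains the axisymmetric no-swirl profiles but is an
  infinite-dimensional, symmetry-free class), is trivial — for every `α`, including the window.

Both become unconditional the moment stub B2 (`stub_rotatingConjugateDensity`) lands (one-line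
instantiation `h2 := stub_rotatingConjugateDensity`). Contrapositive for B5b: a window soliton
has co-rotating axial vorticity `α Ω₃ > 0` somewhere (indeed on a set of positive `m_α`-mass).

## References

* B. Pineau, V. Vicol, arXiv:2607.09619 (2026): Prop. 3.1 (p. 10), (4.3)–(4.6) (pp. 11–12),
  Prop. 5.1 and (5.4) (pp. 12–13). [PineauVicol2026]
-/

noncomputable section

namespace Summit.NavierStokesRegularity.NavierStokesRegularity.Theorems

open MeasureTheory Set Function Filter Topology InnerProductSpace Real Metric
open scoped RealInnerProductSpace Laplacian ContDiff BigOperators ENNReal NNReal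
open Literature.Analysis.FluidPDE Literature.Analysis.FluidPDE.PineauVicol2026

/-- **Counter-rotating axial vorticity excludes Type-I solitons (modulo the conjugate density
B2).** Assume stub B2 of the line (existence of the rotating conjugate density with constants
uniform on `|α| ≤ A`; hypothesis `h2`). Let `(u, p)` be a classical Navier–Stokes solution on
`[−1, 0)` with the Type-I bound `‖u(t,x)‖ ≤ C₀/(‖x‖ + √−t)`, rotated self-similar with a `C²`
profile `U` and speed `α`. If `α (curl U)₂(y) ≤ 0` for every `y`, then `U = 0`: with B2's density
`m`, the soliton identity of B3 (fed with the landed B1) reads `∫ |curl U|² m = 2∫ α(curl U)₂ m ≤ 0`,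
below the threshold `ε₀ > 0` of the landed gap lemma B4.
[cite: PineauVicol2026, Prop. 3.1 (p. 10), (5.4) (p. 13)] -/
theorem axialVorticity_liouville_of_density
    (h2 : ∀ C₀ : ℝ, 0 < C₀ → ∀ A : ℝ, 0 ≤ A → ∃ c M₁ : ℝ, 0 < c ∧ 0 < M₁ ∧ ∀ (α : ℝ) (u : ℝ → EuclideanSpace ℝ (Fin 3) → EuclideanSpace ℝ (Fin 3)) (p : ℝ → EuclideanSpace ℝ (Fin 3) → ℝ) (U : EuclideanSpace ℝ (Fin 3) → EuclideanSpace ℝ (Fin 3)), |α| ≤ A → Literature.Analysis.FluidPDE.IsClassicalNSSolutionOn (Set.Ico (-1) 0) 1 0 u p → (∀ t ∈ Set.Ico (-1 : ℝ) 0, ∀ x : EuclideanSpace ℝ (Fin 3), ‖u t x‖ ≤ C₀ / (‖x‖ + Real.sqrt (-t))) → ContDiff ℝ 2 U → (∀ t ∈ Set.Ico (-1 : ℝ) 0, ∀ x : EuclideanSpace ℝ (Fin 3), u t x = Literature.Analysis.FluidPDE.pvAnsatz α (fun y _ => U y) t x) → ∃ m : EuclideanSpace ℝ (Fin 3) → ℝ,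 ContDiff ℝ 2 m ∧ (∀ y, 0 < m y) ∧ (∫ y, m y = 1) ∧ (∀ y, c * Real.exp (-(7 / 16 : ℝ) * ‖y‖ ^ 2) ≤ m y) ∧ (∀ y, m y ≤ M₁ * Real.exp (-(1 / 16 : ℝ) * ‖y‖ ^ 2)) ∧ (∃ M₂ : ℝ, ∀ y, ‖fderiv ℝ m y‖ ≤ M₂ * Real.exp (-(1 / 32 : ℝ) * ‖y‖ ^ 2)) ∧ (∀ y, Laplacian.laplacian m y + Literature.Analysis.FluidPDE.VectorCalculus.divergence (fun z => m z • (U z + (1 / 2 : ℝ) • z - α • Literature.Analysis.FluidPDE.rotGen z)) y = 0))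
    {C₀ : ℝ} (hC₀ : 0 < C₀) {α : ℝ}
    {u : ℝ → EuclideanSpace ℝ (Fin 3) → EuclideanSpace ℝ (Fin 3)} {p : ℝ → EuclideanSpace ℝ (Fin 3) → ℝ}
    {U : EuclideanSpace ℝ (Fin 3) → EuclideanSpace ℝ (Fin 3)}
    (hsol : IsClassicalNSSolutionOn (Ico (-1) 0) 1 0 u p)
    (hI : ∀ t ∈ Ico (-1 : ℝ) 0, ∀ x, ‖u t x‖ ≤ C₀ / (‖x‖ + Real.sqrt (-t)))
    (hU2 : ContDiff ℝ 2 U)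
    (hans : ∀ t ∈ Ico (-1 : ℝ) 0, ∀ x, u t x = pvAnsatz α (fun y _ => U y) t x)
    (hsign : ∀ y, α * (curl U y) 2 ≤ 0) : U = 0 := by
  -- B2: the conjugate density for this `α` (constants on `|α| ≤ |α|`)
  obtain ⟨c, M₁, hc, hM₁, hdens⟩ := h2 C₀ hC₀ |α| (abs_nonneg α)
  obtain ⟨m, hm⟩ := hdens α u p U le_rfl hsol hI hU2 hans
  -- B3's identity (B1 landed) and B4's threshold
  obtain ⟨-, hid⟩ := stub_solitonLaws stub_twistedHeadIdentity C₀ α u p U m c M₁ hsol hI hU2 hans hm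
  obtain ⟨ε₀, hε₀, hgap⟩ := stub_weightedGapLemma C₀ hC₀ c M₁ hc hM₁
  refine hgap α u p U m hsol hI hU2 hans hm ?_
  have hm0 : ∀ y, 0 ≤ m y := fun y => (hm.2.1 y).le
  have hneg : α * ∫ y, (curl U y) 2 * m y ≤ 0 := by
    rw [← integral_const_mul]
    refine integral_nonpos fun y => ?_
    have h := mul_nonpos_of_nonpos_of_nonneg (hsign y) (hm0 y)
    simpa [mul_assoc] using h
  rw [hid]
  linarith

/-- **Type-I solitons without axial vorticity are trivial (modulo B2), for every rotation rate.**
Under stub B2 of the line (hypothesis `h2`): a classical Navier–Stokes solution on `[−1, 0)`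
with the Type-I bound, rotated self-similar with a `C²` profile `U` whose vorticity has no
component along the rotation axis, `(curl U)₂ ≡ 0` (`∂₁U₂ = ∂₂U₁`: the horizontal velocity is a
gradient in every horizontal plane), has `U = 0`. No smallness, no symmetry, all `α`.
[cite: PineauVicol2026, Prop. 3.1 (p. 10), (5.4) (p. 13)] -/
theorem noAxialVorticity_liouville_of_density
    (h2 : ∀ C₀ : ℝ, 0 < C₀ → ∀ A : ℝ, 0 ≤ A → ∃ c M₁ : ℝ, 0 < c ∧ 0 < M₁ ∧ ∀ (α : ℝ) (u : ℝ → EuclideanSpace ℝ (Fin 3) → EuclideanSpace ℝ (Fin 3)) (p : ℝ → EuclideanSpace ℝ (Fin 3) → ℝ) (U : EuclideanSpace ℝ (Fin 3) → EuclideanSpace ℝ (Fin 3)), |α| ≤ A → Literature.Analysis.FluidPDE.IsClassicalNSSolutionOn (Set.Ico (-1) 0) 1 0 u p → (∀ t ∈ Set.Ico (-1 : ℝ) 0, ∀ x : EuclideanSpace ℝ (Fin 3), ‖u t x‖ ≤ C₀ / (‖x‖ + Real.sqrt (-t))) → ContDiff ℝ 2 U → (∀ t ∈ Set.Ico (-1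 : ℝ) 0, ∀ x : EuclideanSpace ℝ (Fin 3), u t x = Literature.Analysis.FluidPDE.pvAnsatz α (fun y _ => U y) t x) → ∃ m : EuclideanSpace ℝ (Fin 3) → ℝ, ContDiff ℝ 2 m ∧ (∀ y, 0 < m y) ∧ (∫ y, m y = 1) ∧ (∀ y, c * Real.exp (-(7 / 16 : ℝ) * ‖y‖ ^ 2) ≤ m y) ∧ (∀ y, m y ≤ M₁ * Real.exp (-(1 / 16 : ℝ) * ‖y‖ ^ 2)) ∧ (∃ M₂ : ℝ, ∀ y, ‖fderiv ℝ m y‖ ≤ M₂ * Real.exp (-(1 / 32 : ℝ) * ‖y‖ ^ 2)) ∧ (∀ y, Laplacian.laplacian m y + Literature.Analysis.FluidPDE.VectorCalculus.divergence (fun z => m z • (U z + (1 / 2 : ℝ) • z - α • Literature.Analysis.FluidPDE.rotGen z)) y = 0))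
    {C₀ : ℝ} (hC₀ : 0 < C₀) {α : ℝ}
    {u : ℝ → EuclideanSpace ℝ (Fin 3) → EuclideanSpace ℝ (Fin 3)} {p : ℝ → EuclideanSpace ℝ (Fin 3) → ℝ}
    {U : EuclideanSpace ℝ (Fin 3) → EuclideanSpace ℝ (Fin 3)}
    (hsol : IsClassicalNSSolutionOn (Ico (-1) 0) 1 0 u p)
    (hI : ∀ t ∈ Ico (-1 : ℝ) 0, ∀ x, ‖u t x‖ ≤ C₀ / (‖x‖ + Real.sqrt (-t)))
    (hU2 : ContDiff ℝ 2 U)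
    (hans : ∀ t ∈ Ico (-1 : ℝ) 0, ∀ x, u t x = pvAnsatz α (fun y _ => U y) t x)
    (hΩ₃ : ∀ y, (curl U y) 2 = 0) : U = 0 :=
  axialVorticity_liouville_of_density h2 hC₀ hsol hI hU2 hans fun y => by
    rw [hΩ₃ y, mul_zero]


/-! ### Registered form -/

/-- **Registered helper stub `rotationDefect_axialVorticityOfDensity`** (explicit-binder form of
`axialVorticity_liouville_of_density`): modulo stub B2, counter-rotating axial vorticity
(`α (curl U)₂ ≤ 0` everywhere) excludes Type-I rotated self-similar solitons, for every `α`.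
[cite: PineauVicol2026, Prop. 3.1 (p. 10), (5.4) (p. 13)] -/
theorem rotationDefect_axialVorticityOfDensity :
    (∀ C₀ : ℝ, 0 < C₀ → ∀ A : ℝ, 0 ≤ A → ∃ c M₁ : ℝ, 0 < c ∧ 0 < M₁ ∧ ∀ (α : ℝ) (u : ℝ → EuclideanSpace ℝ (Fin 3) → EuclideanSpace ℝ (Fin 3)) (p : ℝ → EuclideanSpace ℝ (Fin 3) → ℝ) (U : EuclideanSpace ℝ (Fin 3) → EuclideanSpace ℝ (Fin 3)), |α| ≤ A → Literature.Analysis.FluidPDE.IsClassicalNSSolutionOn (Set.Ico (-1) 0) 1 0 u p → (∀ t ∈ Set.Ico (-1 : ℝ) 0, ∀ x : EuclideanSpace ℝ (Fin 3), ‖u t x‖ ≤ C₀ / (‖x‖ + Real.sqrt (-t))) → ContDiff ℝ 2 U → (∀ t ∈ Set.Ico (-1 : ℝ) 0, ∀ x : EuclideanSpace ℝ (Fin 3), u t x = Literature.Analysis.FluidPDE.pvAnsatz α (fun y _ => U y) t x) → ∃ m : EuclideanSpace ℝ (Fin 3) → ℝ, ContDiff ℝ 2 m ∧ (∀ y, 0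 < m y) ∧ (∫ y, m y = 1) ∧ (∀ y, c * Real.exp (-(7 / 16 : ℝ) * ‖y‖ ^ 2) ≤ m y) ∧ (∀ y, m y ≤ M₁ * Real.exp (-(1 / 16 : ℝ) * ‖y‖ ^ 2)) ∧ (∃ M₂ : ℝ, ∀ y, ‖fderiv ℝ m y‖ ≤ M₂ * Real.exp (-(1 / 32 : ℝ) * ‖y‖ ^ 2)) ∧ (∀ y, Laplacian.laplacian m y + Literature.Analysis.FluidPDE.VectorCalculus.divergence (fun z => m z • (U z + (1 / 2 : ℝ) • z - α • Literature.Analysis.FluidPDE.rotGen z)) y = 0)) → ∀ (C₀ : ℝ), 0 < C₀ → ∀ (α : ℝ) (u : ℝ → EuclideanSpace ℝ (Fin 3) → EuclideanSpace ℝ (Fin 3)) (p : ℝ → EuclideanSpace ℝ (Fin 3) → ℝ) (U : EuclideanSpace ℝ (Fin 3) → EuclideanSpace ℝ (Fin 3)), Literature.Analysis.FluidPDE.IsClassicalNSSolutionOn (Set.Ico (-1) 0) 1 0 u p → (∀ t ∈ Set.Ico (-1 : ℝ) 0, ∀ x : EuclideanSpace ℝ (Fin 3), ‖u t x‖ ≤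 C₀ / (‖x‖ + Real.sqrt (-t))) → ContDiff ℝ 2 U → (∀ t ∈ Set.Ico (-1 : ℝ) 0, ∀ x : EuclideanSpace ℝ (Fin 3), u t x = Literature.Analysis.FluidPDE.pvAnsatz α (fun y _ => U y) t x) → (∀ y : EuclideanSpace ℝ (Fin 3), α * (Literature.Analysis.FluidPDE.curl U y) 2 ≤ 0) → U = 0 :=
  fun h2 _ hC₀ _ _ _ _ hsol hI hU2 hans hsign =>
    axialVorticity_liouville_of_density h2 hC₀ hsol hI hU2 hans hsign

end Summit.NavierStokesRegularity.NavierStokesRegularity.Theorems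

end
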